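import Mathlib.Analysis.Complex.RemovableSingularity
import Mathlib.Analysis.Complex.OpenMapping
import Mathlib.Analysis.Calculus.InverseFunctionTheorem.Deriv
import Mathlib.Analysis.Calculus.MeanValue
import Mathlib.Geometry.Manifold.MFDeriv.Atlas
import Mathlib.Geometry.Manifold.MFDeriv.NormedSpace
import HarnessLib

/-!
# Holomorphy descends along open holomorphic maps onto curves

Topic `Literature/Analysis/Complex`, namespace `Literature.Analysis.Complex` (grouping sub-namespace
`HolomorphyDescent`). THEOREMS ONLY (no definition, no named fact, no `sorry`).

Let `h` be a holomorphic function of several complex variables near a point `z`, NOT constant near `z`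
(for instance open at `z`), and let `Ψ` be a map into a complete complex normed space, continuous at
`h z`, such that `Ψ ∘ h` is holomorphic near `z`.  Then **`Ψ` is holomorphic at `h z`**
(`HolomorphyDescent.analyticAt_of_comp_of_frequently_ne`).  Proof: restrict `h` to a complex line
through `z` on which it is not constant; the restriction `k` is a non-constant holomorphic function of
ONE variable, hence open at `0` (open mapping theorem) with isolated critical points; off the critical
values `Ψ = (Ψ ∘ k) ∘ k⁻¹` locally (holomorphic inverse function theorem), so `Ψ` is holomorphic on a
punctured neighbourhood of `h z`, and Riemann's removable singularities theorem ([Forster1981] §1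
Thm. 1.8; [FritzscheGrauert2002] Ch. I §8 Thm. 8.2, `n = 1`) finishes since `Ψ` is continuous at `h z`.

The manifold form (`HolomorphyDescent.mdifferentiableAt_of_comp_of_nhds_le_map`): for a map
`u : G → M` from a complex normed space to a complex manifold `M` OF DIMENSION ONE, holomorphic near `z`
and open at `z` (`𝓝 (u z) ≤ map u (𝓝 z)`), and `Φ : M → M'` into any complex manifold, continuous at
`u z` with `Φ ∘ u` holomorphic near `z`, the map `Φ` is holomorphic at `u z`.  This is the form in which
«a map between quotients `Γ₁ \ 𝔻 → Γ₂ \ 𝔻` of the disc that lifts to a holomorphic map of the disc is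
holomorphic» is used for compact Shimura CURVES (uniformisation = an open holomorphic map from the
negative cone onto the curve), WITHOUT a local-biholomorphy / proper-discontinuity statement for the
uniformisation ([Forster1981] §1 Def. 1.9, Thm. 1.8; the dimension-one hypothesis is essential).

## References
* [Forster1981] O. Forster, *Lectures on Riemann Surfaces*, GTM 81 (1981), §1 Thm. 1.8 (Riemann's
  Removable Singularities Theorem), Def. 1.9, Thm. 1.11 (Identity Theorem).
* [FritzscheGrauert2002] K. Fritzsche, H. Grauert, *From Holomorphic Functions to Complex Manifolds*
  (2002), Ch. I §8 Thm. 8.2 (Riemann extension theorem), Thm. 8.5.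
-/

noncomputable section

open Filter Topology Set Metric Function
open scoped Manifold ContDiff

namespace Literature.Analysis.Complex

namespace HolomorphyDescent

variable {G : Type*} [NormedAddCommGroup G] [NormedSpace ℂ G]
  {F : Type*} [NormedAddCommGroup F] [NormedSpace ℂ F] [CompleteSpace F]

/-! ### §1. The core statement in several complex variables -/

omit [NormedSpace ℂ G] in
/-- A map open at `z` into `ℂ` is not constant near `z`: if `𝓝 (h z) ≤ map h (𝓝 z)` then
`h y ≠ h z` frequently near `z` (`ℂ` has no isolated point). [cite: Forster1981, §1 Thm. 1.11] -/
theorem frequently_ne_of_nhds_le_map {h : G → ℂ} {z : G} (hopen : 𝓝 (h z) ≤ map h (𝓝 z)) :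
    ∃ᶠ y in 𝓝 z, h y ≠ h z := by
  rw [Filter.frequently_iff_neBot]
  by_contra hbot
  rw [not_neBot, inf_principal_eq_bot] at hbot
  -- `hbot : {y | ¬ (h y ≠ h z)} ∈ 𝓝 z`, so `{h z} ∈ 𝓝 (h z)`
  have h1 : ({h z} : Set ℂ) ∈ 𝓝 (h z) := by
    refine hopen (Filter.mem_map.2 ?_)
    filter_upwards [hbot] with y hy
    simpa using hy
  have h2 : (∅ : Set ℂ) ∈ 𝓝[≠] (h z) := by
    have := inter_mem_nhdsWithin ({h z}ᶜ : Set ℂ) h1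
    rwa [Set.compl_inter_self] at this
  exact (NormedField.nhdsNE_neBot (h z)).ne (Filter.empty_mem_iff_bot.mp h2)

/-- **Holomorphy descends along non-constant holomorphic maps (several variables → one).**  Let
`h : G → ℂ` be complex-differentiable near `z`, not constant near `z` (`h y ≠ h z` frequently near `z`),
and let `Ψ : ℂ → F` (`F` complete) be continuous at `h z` with `Ψ ∘ h` complex-differentiable near `z`.
Then `Ψ` is analytic at `h z`.  (Restrict `h` to a complex line where it is not constant; one-variable
open mapping theorem, holomorphic inverse function theorem off the isolated critical points, and
Riemann's removable singularities theorem at `h z`.)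
[cite: Forster1981, §1 Thm. 1.8] [cite: FritzscheGrauert2002, Ch. I §8 Thm. 8.2] -/
theorem analyticAt_of_comp_of_frequently_ne {h : G → ℂ} {Ψ : ℂ → F} {z : G}
    (hh : ∀ᶠ y in 𝓝 z, DifferentiableAt ℂ h y) (hnc : ∃ᶠ y in 𝓝 z, h y ≠ h z)
    (hΨh : ∀ᶠ y in 𝓝 z, DifferentiableAt ℂ (Ψ ∘ h) y) (hΨ : ContinuousAt Ψ (h z)) :
    AnalyticAt ℂ Ψ (h z) := by
  -- Step 1: a ball on which `h` and `Ψ ∘ h` are differentiable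
  obtain ⟨r, hr, hball⟩ : ∃ r > 0, ∀ y ∈ ball z r,
      DifferentiableAt ℂ h y ∧ DifferentiableAt ℂ (Ψ ∘ h) y :=
    Metric.eventually_nhds_iff_ball.mp (hh.and hΨh)
  -- Step 2: a point `z'` of the ball with `h z' ≠ h z`
  obtain ⟨z', hz'ne, hz'mem⟩ : ∃ z', h z' ≠ h z ∧ z' ∈ ball z r :=
    (hnc.and_eventually (ball_mem_nhds z hr)).exists
  -- Step 3: the complex line `ℓ t = z + t • (z' - z)` and `k = h ∘ ℓ` on `D = ℓ ⁻¹' ball z r`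
  set ℓ : ℂ → G := fun t => z + t • (z' - z) with hℓ
  have hℓ0 : ℓ 0 = z := by simp [hℓ]
  have hℓ1 : ℓ 1 = z' := by simp [hℓ]
  have hℓd : Differentiable ℂ ℓ := (differentiable_const z).add (differentiable_id.smul_const _)
  set D : Set ℂ := ℓ ⁻¹' ball z r with hD
  have hDo : IsOpen D := isOpen_ball.preimage hℓd.continuous
  have hD0 : (0 : ℂ) ∈ D := by
    change ℓ 0 ∈ ball z r
    rw [hℓ0]
    exact mem_ball_self hr
  have hD1 : (1 : ℂ) ∈ D := by
    change ℓ 1 ∈ ball z r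
    rw [hℓ1]
    exact hz'mem
  have hDconv : Convex ℝ D := by
    intro t₁ ht₁ t₂ ht₂ a b ha hb hab
    change ℓ (a • t₁ + b • t₂) ∈ ball z r
    have hcomb : ℓ (a • t₁ + b • t₂) = a • ℓ t₁ + b • ℓ t₂ := by
      simp only [hℓ]
      rw [smul_add, smul_add, add_add_add_comm, ← add_smul, hab, one_smul, add_smul, smul_assoc,
        smul_assoc]
    rw [hcomb]
    exact convex_ball z r ht₁ ht₂ ha hb hab
  set k : ℂ → ℂ := h ∘ ℓ with hk
  have hk0z : k 0 = h z := by simp [hk, hℓ0]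
  -- Step 4: `k` is analytic on `D`
  have hkd : DifferentiableOn ℂ k D := fun t ht =>
    ((hball _ ht).1.comp t (hℓd t)).differentiableWithinAt
  have hka : AnalyticOnNhd ℂ k D := hkd.analyticOnNhd hDo
  have hk0 : AnalyticAt ℂ k 0 := hka 0 hD0
  -- Step 5: `k` is not constant near `0` (identity theorem on the convex set `D ∋ 0, 1`)
  have hnc0 : ¬ (∀ᶠ t in 𝓝 (0 : ℂ), k t = k 0) := by
    intro hev
    have heq : EqOn k (fun _ => k 0) D :=
      hka.eqOn_of_preconnected_of_eventuallyEq analyticOnNhd_const hDconv.isPreconnected hD0 hev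
    have h10 : k 1 = k 0 := heq hD1
    simp only [hk, Function.comp_apply, hℓ1, hℓ0] at h10
    exact hz'ne h10
  -- Step 6: open mapping theorem for `k` at `0`
  have hmap : 𝓝 (k 0) ≤ map k (𝓝 0) := (hk0.eventually_constant_or_nhds_le_map_nhds).resolve_left hnc0
  -- Step 7: the critical points of `k` near `0` are isolated
  have hk'ne : ∀ᶠ t in 𝓝[≠] (0 : ℂ), deriv k t ≠ 0 := by
    rcases hk0.deriv.eventually_eq_zero_or_eventually_ne_zero with hzero | hne
    · exfalso
      apply hnc0
      obtain ⟨ε, hε, hεsub⟩ : ∃ ε > 0, ball (0 : ℂ) ε ⊆ {t | deriv k t = 0} ∩ D :=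
        Metric.mem_nhds_iff.mp (inter_mem hzero (hDo.mem_nhds hD0))
      filter_upwards [ball_mem_nhds (0 : ℂ) hε] with t ht
      have hle := (convex_ball (0 : ℂ) ε).norm_image_sub_le_of_norm_deriv_le (f := k) (C := 0)
        (fun x hx => (hka x (hεsub hx).2).differentiableAt)
        (fun x hx => by rw [(hεsub hx).1, norm_zero]) (mem_ball_self hε) ht
      rw [zero_mul, norm_le_zero_iff, sub_eq_zero] at hle
      exact hle
    · exact hne
  -- Step 8: `Ψ` is differentiable on a punctured neighbourhood of `k 0 = h z`
  have key : ∀ᶠ w in 𝓝[≠] (h z), DifferentiableAt ℂ Ψ w := by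
    rw [← hk0z]
    have hS : ({t : ℂ | t ≠ 0 → deriv k t ≠ 0} ∩ D) ∈ 𝓝 (0 : ℂ) :=
      inter_mem (eventually_nhdsWithin_iff.mp hk'ne) (hDo.mem_nhds hD0)
    have himg : k '' ({t : ℂ | t ≠ 0 → deriv k t ≠ 0} ∩ D) ∈ 𝓝 (k 0) := hmap (image_mem_map hS)
    refine eventually_nhdsWithin_iff.mpr ?_
    filter_upwards [himg] with w hw hwne
    obtain ⟨t, ⟨ht, htD⟩, rfl⟩ := hw
    have ht0 : t ≠ 0 := fun h0 => hwne (by rw [h0]; exact mem_singleton _)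
    have hkt : deriv k t ≠ 0 := ht ht0
    have hsd : HasStrictDerivAt k (deriv k t) t :=
      ((hka t htD).contDiffAt (n := 1)).hasStrictDerivAt one_ne_zero
    -- the holomorphic local inverse `σ` of `k` at `t`
    have hσr : ∀ᶠ x in 𝓝 (k t), k (hsd.localInverse k _ _ hkt x) = x := hsd.eventually_right_inverse hkt
    have hσd : HasStrictDerivAt (hsd.localInverse k _ _ hkt) (deriv k t)⁻¹ (k t) := hsd.to_localInverse hkt
    have hσt : hsd.localInverse k _ _ hkt (k t) = t := (hsd.eventually_left_inverse hkt).self_of_nhds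
    have hcomp : DifferentiableAt ℂ ((Ψ ∘ h ∘ ℓ) ∘ hsd.localInverse k _ _ hkt) (k t) := by
      have h1 : DifferentiableAt ℂ (Ψ ∘ h ∘ ℓ) (hsd.localInverse k _ _ hkt (k t)) := by
        rw [hσt]
        exact (hball _ htD).2.comp t (hℓd t)
      exact h1.comp _ (HasStrictDerivAt.hasDerivAt hσd).differentiableAt
    refine (Filter.EventuallyEq.differentiableAt_iff ?_).mp hcomp
    filter_upwards [hσr] with x hx
    simp only [Function.comp_apply]
    change Ψ (k _) = Ψ x
    rw [hx]
  -- Step 9: Riemann's removable singularities theorem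
  exact Complex.analyticAt_of_differentiable_on_punctured_nhds_of_continuousAt key hΨ

/-- The same with openness of `h` at `z` in place of non-constancy.
[cite: Forster1981, §1 Thm. 1.8] [cite: FritzscheGrauert2002, Ch. I §8 Thm. 8.2] -/
theorem analyticAt_of_comp_of_nhds_le_map {h : G → ℂ} {Ψ : ℂ → F} {z : G}
    (hh : ∀ᶠ y in 𝓝 z, DifferentiableAt ℂ h y) (hopen : 𝓝 (h z) ≤ map h (𝓝 z))
    (hΨh : ∀ᶠ y in 𝓝 z, DifferentiableAt ℂ (Ψ ∘ h) y) (hΨ : ContinuousAt Ψ (h z)) :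
    AnalyticAt ℂ Ψ (h z) :=
  analyticAt_of_comp_of_frequently_ne hh (frequently_ne_of_nhds_le_map hopen) hΨh hΨ

/-! ### §2. The manifold form: targets of dimension one -/

variable {E₁ : Type*} [NormedAddCommGroup E₁] [NormedSpace ℂ E₁] [FiniteDimensional ℂ E₁]
  {M : Type*} [TopologicalSpace M] [ChartedSpace E₁ M] [IsManifold 𝓘(ℂ, E₁) ω M]
  {E' : Type*} [NormedAddCommGroup E'] [NormedSpace ℂ E'] [CompleteSpace E']
  {M' : Type*} [TopologicalSpace M'] [ChartedSpace E' M'] [IsManifold 𝓘(ℂ, E') ω M']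

/-- **Holomorphy descends along open holomorphic maps onto a complex manifold of dimension one.**  Let
`M` be a complex manifold modelled on a one-dimensional space `E₁`, `M'` a complex manifold, `u : G → M`
holomorphic near `z` and open at `z` (`𝓝 (u z) ≤ map u (𝓝 z)`), and `Φ : M → M'` continuous at `u z` with
`Φ ∘ u` holomorphic near `z`.  Then `Φ` is holomorphic at `u z` (read everything in the extended charts at
`u z` and `Φ (u z)` and apply `analyticAt_of_comp_of_nhds_le_map`).  This is how a continuous map of
Riemann surfaces that becomes holomorphic after composition with a non-constant holomorphic map is seen
to be holomorphic. [cite: Forster1981, §1 Thm. 1.8 and Def. 1.9] [cite: FritzscheGrauert2002, Ch. I §8 Thm. 8.2] -/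
theorem mdifferentiableAt_of_comp_of_nhds_le_map (h1 : Module.finrank ℂ E₁ = 1)
    {u : G → M} {Φ : M → M'} {z : G}
    (hu : ∀ᶠ y in 𝓝 z, MDifferentiableAt 𝓘(ℂ, G) 𝓘(ℂ, E₁) u y)
    (hopen : 𝓝 (u z) ≤ map u (𝓝 z))
    (hΦu : ∀ᶠ y in 𝓝 z, MDifferentiableAt 𝓘(ℂ, G) 𝓘(ℂ, E') (Φ ∘ u) y)
    (hΦ : ContinuousAt Φ (u z)) :
    MDifferentiableAt 𝓘(ℂ, E₁) 𝓘(ℂ, E') Φ (u z) := by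
  set x := u z with hx
  set c := extChartAt 𝓘(ℂ, E₁) x with hc
  set c' := extChartAt 𝓘(ℂ, E') (Φ x) with hc'
  let e : E₁ ≃L[ℂ] ℂ := ContinuousLinearEquiv.ofFinrankEq (h1.trans (Module.finrank_self ℂ).symm)
  have huc : ContinuousAt u z := hu.self_of_nhds.continuousAt
  have hΦuc : ContinuousAt (Φ ∘ u) z := hΦu.self_of_nhds.continuousAt
  have hsrc : ∀ᶠ y in 𝓝 z, u y ∈ (chartAt E₁ x).source :=
    huc.preimage_mem_nhds ((chartAt E₁ x).open_source.mem_nhds (mem_chart_source E₁ x))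
  have hsrc' : ∀ᶠ y in 𝓝 z, (Φ ∘ u) y ∈ (chartAt E' (Φ x)).source :=
    hΦuc.preimage_mem_nhds ((chartAt E' (Φ x)).open_source.mem_nhds (mem_chart_source E' (Φ x)))
  -- the one-variable data
  set hh : G → ℂ := fun y => e (c (u y)) with hhh
  set Ψ : ℂ → E' := fun w => c' (Φ (c.symm (e.symm w))) with hΨdef
  -- (a) `hh` is differentiable near `z`
  have ha : ∀ᶠ y in 𝓝 z, DifferentiableAt ℂ hh y := by
    filter_upwards [hu, hsrc] with y hy hys
    have h3 : MDifferentiableAt 𝓘(ℂ, G) 𝓘(ℂ, E₁) (c ∘ u) y :=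
      (mdifferentiableAt_extChartAt hys).comp y hy
    exact e.differentiableAt.comp y (mdifferentiableAt_iff_differentiableAt.mp h3)
  -- (b) `hh` is open at `z`
  have hb : 𝓝 (hh z) ≤ map hh (𝓝 z) := by
    have hcx : map c (𝓝 x) = 𝓝 (c x) := map_extChartAt_nhds_of_boundaryless x
    have hex : map e (𝓝 (c x)) = 𝓝 (e (c x)) := e.toHomeomorph.map_nhds_eq (c x)
    calc 𝓝 (hh z) = map e (map c (𝓝 x)) := by rw [hcx, hex]
      _ ≤ map e (map c (map u (𝓝 z))) := map_mono (map_mono hopen)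
      _ = map hh (𝓝 z) := by rw [map_map, map_map]; rfl
  -- (c) `Ψ ∘ hh` is differentiable near `z`
  have hcc : ∀ᶠ y in 𝓝 z, DifferentiableAt ℂ (Ψ ∘ hh) y := by
    filter_upwards [hΦu, hsrc', eventually_eventually_nhds.mpr hsrc] with y hy hys' hys
    have h3 : MDifferentiableAt 𝓘(ℂ, G) 𝓘(ℂ, E') (c' ∘ (Φ ∘ u)) y :=
      (mdifferentiableAt_extChartAt hys').comp y hy
    have h4 : DifferentiableAt ℂ (c' ∘ (Φ ∘ u)) y := mdifferentiableAt_iff_differentiableAt.mp h3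
    refine (Filter.EventuallyEq.differentiableAt_iff ?_).mpr h4
    filter_upwards [hys] with y' hy'
    simp only [hΨdef, hhh, Function.comp_apply, ContinuousLinearEquiv.symm_apply_apply]
    rw [(extChartAt 𝓘(ℂ, E₁) x).left_inv (by rwa [extChartAt_source])]
  -- (d) `Ψ` is continuous at `hh z`
  have hd : ContinuousAt Ψ (hh z) := by
    have h0 : c.symm (e.symm (hh z)) = x := by
      simp only [hhh, ContinuousLinearEquiv.symm_apply_apply]
      exact extChartAt_to_inv x
    have h1' : ContinuousAt (fun w => c.symm (e.symm w)) (hh z) := by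
      refine ContinuousAt.comp_of_eq (continuousAt_extChartAt_symm x) e.symm.continuous.continuousAt ?_
      simp only [hhh, ContinuousLinearEquiv.symm_apply_apply]
      rfl
    have h2' : ContinuousAt (fun w => Φ (c.symm (e.symm w))) (hh z) :=
      ContinuousAt.comp_of_eq hΦ h1' h0
    exact ContinuousAt.comp_of_eq (continuousAt_extChartAt (Φ x)) h2' (by rw [h0])
  -- (e) the core lemma
  have hΨ : AnalyticAt ℂ Ψ (hh z) := analyticAt_of_comp_of_nhds_le_map ha hb hcc hd
  -- (f) conclusion, in the charts at `x` and `Φ x`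
  rw [mdifferentiableAt_iff]
  refine ⟨hΦ, ?_⟩
  rw [ModelWithCorners.Boundaryless.range_eq_univ, differentiableWithinAt_univ]
  have hw : writtenInExtChartAt 𝓘(ℂ, E₁) 𝓘(ℂ, E') x Φ = Ψ ∘ e := by
    funext w
    simp only [writtenInExtChartAt, hΨdef, Function.comp_apply, ContinuousLinearEquiv.symm_apply_apply]
    rfl
  rw [hw]
  have hΨ' : DifferentiableAt ℂ Ψ (e (c x)) := hΨ.differentiableAt
  exact hΨ'.comp (c x) e.differentiableAt

end HolomorphyDescent

end Literature.Analysis.Complex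

end
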